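import Literature.Probability.LatticeModels.BattleFederbushExpansion
import HarnessLib

/-!
# The weights of the Battle–Brydges–Federbush interpolation are probability weights
(Mastropietro 2008, Lemma 2.3)

Topic `Literature/Probability/LatticeModels`; continuation of `BattleFederbushExpansion.lean`.
In the peeling formula `f(1) = Σ_s ∫_{[0,1]^ι} w_s (∂^s f)(σ_s)` many scripts `s` share the same
**anchored (cluster) tree** — the set of their lines `{ℓ₁, …, ℓ_k}`; they differ by the order in
which the points were added (Mastropietro's "sets `X₂, …, X_{r-1}` compatible with `T`").
**Lemma 2.3** of Mastropietro 2008 ((2.102)–(2.108)) states that the total weight of the scripts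
with a given tree is one,

`Σ_{s : lines(s) = T} ∫_{[0,1]^ι} w_s(t) dt = 1`,

so that `dP_T = Σ_{s ↦ T} w_s dt` "can be interpreted as a probability measure" (loc. cit. (2.103);
Benfatto–Giuliani–Mastropietro 2006, after (2.66)).  The book proves it by computing
`∫ w_s = ∏_k b_k⁻¹` and counting the compatible sequences (`∏ b_k` of them, weighted).  Here we give a
two-line proof *from the peeling formula itself*: apply it to the square-free monomial
`f_T = ∏_{ℓ ∈ T} s_ℓ`.  Then `f_T(1) = 1`; the iterated line derivative of `f_T` along a script is
the product of the variables of the lines of `T` not used (or `0`), and at the decoupled point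
`σ_s` this product vanishes unless the script uses *all* lines of `T` — because the lines of a
script form a connected graph on its points, so a script using only part of `T` leaves a line of
`T` crossing the boundary of its point set, where `σ_s = 0` (`prod_decPt_eq_zero`).

## Main results (namespace `Literature.Probability.LatticeModels.BattleFederbush.Script`)

* `listDeriv_prod_X` — iterated derivatives of a square-free monomial;
* `nodup_lines`, `length_lines`, `card_image_y`, `exists_line_cross` (the lines of a valid
  script are distinct, `k` in number, and connect its `k + 1` points: some line crosses the
  boundary of any root-containing set missing a point);
* `sum_cubeIntegral_weight_eq_one` — **Lemma 2.3**: for every valid script `s₀`,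
  `Σ_k Σ_{s valid, lines(s) = lines(s₀) as sets} ∫ w_s = 1`.

## Sources

V. Mastropietro, *Non-Perturbative Renormalization* (2008), §2.8, Lemma 2.3, (2.102)–(2.108), PDF
pp. 47–48 of the held copy (bib key `Mastropietro2008`); G. Benfatto, A. Giuliani, V. Mastropietro,
Ann. Henri Poincaré 7 (2006), text after (2.66) ("`dP_T(t)` is a probability measure") (bib key
`BenfattoGiulianiMastropietro2006`); D. C. Brydges, Les Houches 1984 (`Brydges1986`).
-/

noncomputable section

open MvPolynomial Finsupp Literature.RingTheory.MvPolynomial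

namespace Literature.Probability.LatticeModels

namespace BattleFederbush

variable {ι : Type*}

/-! ### Iterated derivatives of a square-free monomial -/

section SquareFree

variable {τ : Type*} [DecidableEq τ] {R : Type*} [CommRing R]

/-- `∂_ℓ ∏_{t ∈ T} s_t = ∏_{t ∈ T ∖ {ℓ}} s_t` if `ℓ ∈ T`, and `0` otherwise. [folklore] -/
theorem pderiv_prod_X (T : Finset τ) (ℓ : τ) :
    pderiv ℓ (∏ t ∈ T, (X t : MvPolynomial τ R)) = if ℓ ∈ T then ∏ t ∈ T.erase ℓ, X t else 0 := by
  induction T using Finset.induction_on with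
  | empty => simp
  | insert a T ha ih =>
    rw [Finset.prod_insert ha, Derivation.leibniz, ih, pderiv_X, smul_eq_mul, smul_eq_mul]
    by_cases hℓa : ℓ = a
    · subst hℓa
      rw [if_neg ha, if_pos (Finset.mem_insert_self _ _), Finset.erase_insert ha, mul_zero, zero_add,
        Pi.single_eq_same, mul_one]
    · rw [Pi.single_eq_of_ne (Ne.symm hℓa), mul_zero, add_zero]
      by_cases hℓ : ℓ ∈ T
      · rw [if_pos hℓ, if_pos (Finset.mem_insert_of_mem hℓ), Finset.erase_insert_of_ne (Ne.symm hℓa),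
          Finset.prod_insert (fun h => ha (Finset.mem_of_mem_erase h))]
      · rw [if_neg hℓ, if_neg (by simp [hℓ, hℓa]), mul_zero]

/-- **Iterated derivatives of a square-free monomial**: `∂_{ℓ_k} ⋯ ∂_{ℓ_1} ∏_{t∈T} s_t` is the
product of the remaining variables if the `ℓᵢ` are distinct elements of `T`, and `0` otherwise.
[folklore] -/
theorem listDeriv_prod_X : ∀ (L : List τ) (T : Finset τ),
    listDeriv L (∏ t ∈ T, (X t : MvPolynomial τ R)) =
      if L.Nodup ∧ ∀ ℓ ∈ L, ℓ ∈ T then ∏ t ∈ T \ L.toFinset, X t else 0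
  | [], T => by simp
  | ℓ :: L, T => by
    rw [listDeriv_cons, pderiv_prod_X]
    by_cases hℓ : ℓ ∈ T
    · rw [if_pos hℓ, listDeriv_prod_X L (T.erase ℓ)]
      have hset : T.erase ℓ \ L.toFinset = T \ (ℓ :: L).toFinset := by
        ext t
        simp only [Finset.mem_sdiff, Finset.mem_erase, List.mem_toFinset, List.mem_cons, not_or]
        tauto
      by_cases h : L.Nodup ∧ ∀ ℓ' ∈ L, ℓ' ∈ T.erase ℓ
      · rw [if_pos h, hset, if_pos]
        refine ⟨List.nodup_cons.2 ⟨fun hmem => ?_, h.1⟩, fun ℓ' hℓ' => ?_⟩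
        · exact (Finset.mem_erase.1 (h.2 ℓ hmem)).1 rfl
        · rcases List.mem_cons.1 hℓ' with rfl | hℓ'
          · exact hℓ
          · exact Finset.mem_of_mem_erase (h.2 ℓ' hℓ')
      · rw [if_neg h, if_neg]
        rintro ⟨hnd, hsub⟩
        refine h ⟨(List.nodup_cons.1 hnd).2, fun ℓ' hℓ' => Finset.mem_erase.2 ⟨fun h' => ?_, hsub ℓ' (List.mem_cons_of_mem _ hℓ')⟩⟩
        exact (List.nodup_cons.1 hnd).1 (h' ▸ hℓ')
    · rw [if_neg hℓ, listDeriv_zero, if_neg]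
      rintro ⟨-, hsub⟩
      exact hℓ (hsub ℓ (List.mem_cons_self ..))

end SquareFree

namespace Script

variable {root : ι}

/-! ### The lines of a valid script: distinct, `k` in number, connecting the points -/

/-- A script with `k + 1` points has `k` lines. [folklore] -/
theorem length_lines : {k : ℕ} → (s : Script root k) → s.lines.length = k
  | _, nil => rfl
  | _, snoc s i z => by rw [lines, List.length_append, length_lines s]; rfl

variable [DecidableEq ι]

/-- The lines of a valid script are distinct. [folklore] -/
theorem nodup_lines : {k : ℕ} → (s : Script root k) → s.Valid → s.lines.Nodup
  | _, nil, _ => List.nodup_nil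
  | _, snoc s i z, hv => by
    rw [lines, List.nodup_append]
    refine ⟨nodup_lines s hv.1, List.nodup_singleton _, fun ℓ hℓ ℓ' hℓ' heq => ?_⟩
    rw [List.mem_singleton] at hℓ'
    subst hℓ'; subst heq
    have hz := mem_image_of_mem_lines s _ hℓ z (Sym2.mem_mk_right _ _)
    obtain ⟨m, -, hm⟩ := Finset.mem_image.1 hz
    exact hv.2 m hm

/-- A valid script has `k + 1` distinct points. [folklore] -/
theorem card_image_y {k : ℕ} (s : Script root k) (hs : s.Valid) :
    (Finset.univ.image s.y).card = k + 1 := by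
  rw [Finset.card_image_of_injective _ (y_injective s hs), Finset.card_univ, Fintype.card_fin]

/-- Every point of a script is the root or an endpoint of one of its lines. [folklore] -/
theorem eq_root_or_exists_line {k : ℕ} (s : Script root k) {a : ι} (ha : a ∈ Finset.univ.image s.y) :
    a = root ∨ ∃ ℓ ∈ s.lines, a ∈ ℓ := by
  obtain ⟨m, -, rfl⟩ := Finset.mem_image.1 ha
  by_cases hm : m = 0
  · exact Or.inl (by rw [hm, y_zero])
  · exact Or.inr (exists_mem_lines s m hm)

/-- The lines of a script do not cross the boundary of its point set. [folklore] -/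
theorem crossB_image_of_mem_lines {k : ℕ} (s : Script root k) (ℓ : Sym2 ι) (hℓ : ℓ ∈ s.lines) :
    crossB (Finset.univ.image s.y) ℓ = false := by
  revert hℓ
  refine Sym2.inductionOn ℓ fun a b => ?_
  intro hℓ
  have ha := mem_image_of_mem_lines s _ hℓ a (Sym2.mem_mk_left _ _)
  have hb := mem_image_of_mem_lines s _ hℓ b (Sym2.mem_mk_right _ _)
  simp [ha, hb]

/-- **The lines of a valid script connect its points**: if a set `A` contains the root but misses
a point of the script, some line of the script crosses the boundary of `A`. [folklore] -/
theorem exists_line_cross : {k : ℕ} → (s : Script root k) → ∀ (A : Finset ι), root ∈ A →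
    (∃ m, s.y m ∉ A) → ∃ ℓ ∈ s.lines, crossB A ℓ = true
  | _, nil, A, hA, ⟨m, hm⟩ => absurd hA (by simpa using hm)
  | _, snoc s i z, A, hA, ⟨m, hm⟩ => by
    by_cases h : ∃ m', s.y m' ∉ A
    · obtain ⟨ℓ, hℓ, hc⟩ := exists_line_cross s A hA h
      exact ⟨ℓ, by rw [lines]; exact List.mem_append_left _ hℓ, hc⟩
    · simp only [not_exists, not_not] at h
      have hz : z ∉ A := by
        induction m using Fin.lastCases with
        | last => rwa [y_snoc_last] at hm
        | cast m => rw [y_snoc_castSucc] at hm; exact absurd (h m) hm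
      refine ⟨s(s.y i, z), by simp [lines], ?_⟩
      rw [crossB_mk]
      simp [h i, hz]

section Ring

variable {R : Type*} [CommRing R]

/-- **A script using only part of a tree leaves a crossing line unsaturated**: if the lines of a
valid script `s` are among the lines `T` of a valid script `s₀` but not all of them, then
`∏_{ℓ ∈ T ∖ lines(s)} σ_s(ℓ) = 0`. [folklore] -/
theorem prod_decPt_eq_zero {k₀ k : ℕ} (s₀ : Script root k₀) (hs₀ : s₀.Valid) (s : Script root k)
    (hs : s.Valid) (hsub : ∀ ℓ ∈ s.lines, ℓ ∈ s₀.lines.toFinset)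
    (hne : s.lines.toFinset ≠ s₀.lines.toFinset) :
    ∏ ℓ ∈ s₀.lines.toFinset \ s.lines.toFinset, decPt R s ℓ = 0 := by
  -- the point set of `s` is a proper subset of that of `s₀`
  have hpts : Finset.univ.image s.y ⊆ Finset.univ.image s₀.y := by
    intro a ha
    rcases eq_root_or_exists_line s ha with rfl | ⟨ℓ, hℓ, haℓ⟩
    · exact Finset.mem_image.2 ⟨0, Finset.mem_univ _, y_zero s₀⟩
    · exact mem_image_of_mem_lines s₀ ℓ (List.mem_toFinset.1 (hsub ℓ hℓ)) a haℓ
  have hcard : (Finset.univ.image s.y).card < (Finset.univ.image s₀.y).card := by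
    rw [card_image_y s hs, card_image_y s₀ hs₀]
    have h1 : s.lines.toFinset.card = k := by
      rw [List.toFinset_card_of_nodup (nodup_lines s hs), length_lines]
    have h2 : s₀.lines.toFinset.card = k₀ := by
      rw [List.toFinset_card_of_nodup (nodup_lines s₀ hs₀), length_lines]
    have hsub' : s.lines.toFinset ⊆ s₀.lines.toFinset := fun ℓ hℓ => hsub ℓ (List.mem_toFinset.1 hℓ)
    have := Finset.card_lt_card (Finset.ssubset_iff_subset_ne.2 ⟨hsub', hne⟩)
    omega
  obtain ⟨a, ha₀, ha⟩ := Finset.exists_of_ssubset (Finset.ssubset_iff_subset_ne.2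
    ⟨hpts, fun h => (h ▸ hcard).false⟩)
  obtain ⟨m, -, rfl⟩ := Finset.mem_image.1 ha₀
  -- a line of `s₀` crosses the boundary of the point set of `s`
  obtain ⟨ℓ, hℓ, hc⟩ := exists_line_cross s₀ (Finset.univ.image s.y)
    (Finset.mem_image.2 ⟨0, Finset.mem_univ _, y_zero s⟩) ⟨m, ha⟩
  have hℓs : ℓ ∉ s.lines.toFinset := fun h => by
    -- lines of `s` lie inside its point set, hence do not cross it
    rw [crossB_image_of_mem_lines s ℓ (List.mem_toFinset.1 h)] at hc
    exact Bool.false_ne_true hc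
  refine Finset.prod_eq_zero (Finset.mem_sdiff.2 ⟨List.mem_toFinset.2 hℓ, hℓs⟩) ?_
  rw [decPt, pre_eq_image s le_rfl, if_pos hc]

variable [Fintype ι] [Algebra ℚ R]

/-- The term of a script in the peeling expansion of the square-free monomial of the lines of
`s₀`: `∫ w_s` if the script has the same lines, `0` otherwise. [folklore] -/
theorem term_prod_X_lines {k₀ k : ℕ} (s₀ : Script root k₀) (hs₀ : s₀.Valid) (s : Script root k)
    (hs : s.Valid) :
    term R (∏ ℓ ∈ s₀.lines.toFinset, X ℓ) s =
      if s.lines.toFinset = s₀.lines.toFinset then cubeIntegral ι R (weight R s) else 0 := by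
  rw [term, lineDeriv_eq, listDeriv_prod_X]
  by_cases hsub : ∀ ℓ ∈ s.lines, ℓ ∈ s₀.lines.toFinset
  · rw [if_pos ⟨nodup_lines s hs, hsub⟩, map_prod]
    simp_rw [aeval_X]
    by_cases heq : s.lines.toFinset = s₀.lines.toFinset
    · rw [if_pos heq, heq, Finset.sdiff_self, Finset.prod_empty, mul_one]
    · rw [if_neg heq, prod_decPt_eq_zero s₀ hs₀ s hs hsub heq, mul_zero, map_zero]
  · rw [if_neg (fun h => hsub h.2), map_zero, mul_zero, map_zero, if_neg]
    intro heq
    exact hsub fun ℓ hℓ => heq ▸ List.mem_toFinset.2 hℓ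

/-- **Lemma 2.3 of Mastropietro 2008 — the interpolation weights are probability weights.**  For
every valid script `s₀`, the formal cube integrals of the weights of all the valid scripts having
the same lines (the same anchored cluster tree, traversed in any compatible order) add up to `1`:
`Σ_{s : lines(s) = T} ∫_{[0,1]^ι} w_s(t) dt = 1` ((2.102); hence `dP_T(t) = Σ_{s ↦ T} w_s(t) dt` is a
probability measure, (2.103), as used in BGM 2006 after (2.66)).  Proof: the peeling formula for
`f = ∏_{ℓ∈T} s_ℓ`. [cite: Mastropietro2008, Lemma 2.3 (2.102)] -/
theorem sum_cubeIntegral_weight_eq_one {k₀ : ℕ} (s₀ : Script root k₀) (hs₀ : s₀.Valid) :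
    ∑ k ∈ Finset.range (Fintype.card ι), ∑ s : Script root k,
      (if s.Valid ∧ s.lines.toFinset = s₀.lines.toFinset then cubeIntegral ι R (weight R s) else 0) = 1 := by
  have h := eval_one_eq_sum_term (R := R) (root := root) (∏ ℓ ∈ s₀.lines.toFinset, X ℓ)
  rw [map_prod] at h
  simp only [eval_X, Finset.prod_const_one] at h
  rw [h]
  refine Finset.sum_congr rfl fun k _ => Finset.sum_congr rfl fun s _ => ?_
  by_cases hs : s.Valid
  · rw [if_pos hs, term_prod_X_lines s₀ hs₀ s hs]
    simp only [hs, true_and]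
  · rw [if_neg hs, if_neg (fun h => hs h.1)]

end Ring

end Script

end BattleFederbush

end Literature.Probability.LatticeModels
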